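import Summits.QuantumFields.YangMills.Theorems.ChatterjeeMassGapTorusAxialBetaZero
import Literature.MathematicalPhysics.QuantumFieldTheory.StrongCouplingActivities
import Literature.MathematicalPhysics.QuantumFieldTheory.LatticeGaugeProofs
import Literature.MathematicalPhysics.QuantumLattice.ContinuumLimitLGT
import Literature.MathematicalPhysics.QuantumLattice.LatticeGaugeDLRLimitPointsProofs
import Literature.Barriers.QuantumFields.AbelianDeconfinementD4Proofs
import HarnessLib

/-!
# `β = 0` is ULTRA-LOCAL: every torus-limit state has plaquette two-point function supported
# at the origin (record on the `S28ᵀ` β-axis; supports `DirichletWindow.XiDiverges`)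

`ChatterjeeMassGapTorusAxialBetaZero` showed that at `β = 0` the axial values `f_{0,μ}(n e₀)`,
`n ≥ 2`, of the connected plaquette two-point function of a torus-limit state vanish (disjoint
supports + independence), whence `HasInvCorrLength f 0` through the junk value `Real.log 0 = 0`
and the failure of the `S28ᵀ` gap clause at `β = 0`.  This file makes the word DEGENERATE
precise: `f_{0,μ}(x) = 0` for EVERY `x ≠ 0` (`plaquetteCorrFn_eq_zero_of_ne_zero`) — also
where the two plaquettes SHARE an edge — so `f_{0,μ}` has every exponential decay rate `m > 0`
with constant `|f(0)|` (`hasExponentialDecayRate_of_beta_zero`, `betaZero_degenerate`): the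
`ℓ^∞` correlation length is `0`; only the logarithmic axial reading `HasInvCorrLength` says `0`.

Mechanism (spectral/trace card — one free Peter–Weyl mode): under the `β = 0` Wilson measure
(= Haar product, `S28BetaZero.wilsonMeasure_zero`) right-translating ONE edge variable
`V e₀ ↦ V e₀ g` preserves the measure (`measurePreserving_mulCoord`, unimodularity); averaging
over `g` and using two-sided invariance of Haar measure, an observable `φ(V e₀ · B V)` with `B`
free of `e₀` is uncorrelated with anything free of `e₀` (`integral_mul_eq_of_freeEdge`).  The
origin plaquette is `Re tr ρ(V t₁ V t₂ (V t₃)⁻¹ (V t₄)⁻¹)`; a plaquette at `y ≠ 0` in the same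
plane misses `t₁` unless `y = -e₁`, where it misses `t₂` and cyclicity of the trace puts `t₂`
first (`torusPlaquette_factor_first/second`).  Distinct edges of `ℤ⁴` have distinct torus
images for large periods (`eventually_torusEdge_ne`); the exact torus factorisation passes to
limit states by `S28TorusAxialStrong.abs_plaquetteCorrFn_le_of_eventually`.  No summit
statement is proved here; `G` compact metrisable, `ρ` continuous, `d = 4`.
-/

noncomputable section

open MeasureTheory Filter Topology ProbabilityTheory
open Literature.MathematicalPhysics.QuantumFieldTheory Literature.MathematicalPhysics.QuantumLattice
open Literature.Probability.LatticeModels (Site HasInvCorrLength HasExponentialDecayRate Torus.proj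
  Torus.proj_apply)
open Literature.Barriers.QuantumFields (plaquetteObs_configShift)

namespace Summit.QuantumFields.YangMills.Theorems.S28BetaZeroUltraLocal

variable {G : Type} [Group G] {N : ℕ} (ρ : G →* Matrix (Fin N) (Fin N) ℂ)

/-! ### The torus plaquette observables in coordinates -/

/-- Cyclicity of the trace on the group: `tr ρ(ab) = tr ρ(ba)`. [folklore] -/
theorem trace_rho_mul_comm (a b : G) : (ρ (a * b)).trace = (ρ (b * a)).trace := by
  rw [map_mul, map_mul, Matrix.trace_mul_comm]

/-- The torus plaquette observable at `y` in the `(0,1)` plane, in coordinates. [folklore] -/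
theorem toTorusObservable_plaquetteObs_apply (L : ℕ) (y : Site 4) (V : GaugeConfig 4 L G) :
    toTorusObservable L (plaquetteObs (d := 4) ρ y 0 1) V =
      (ρ (V (torusEdge L (y, 0)) * V (torusEdge L (y + Pi.single 0 1, 1)) *
        (V (torusEdge L (y + Pi.single 1 1, 0)))⁻¹ * (V (torusEdge L (y, 1)))⁻¹)).trace.re :=
  rfl

/-- First-letter form of the origin torus plaquette: `P₀ᵀ(V) = Re tr ρ(V t₁ · B V)` with
`B V = V t₂ (V t₃)⁻¹ (V t₄)⁻¹`. [folklore] -/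
theorem toTorusObservable_plaquetteObs_zero_first (L : ℕ) (V : GaugeConfig 4 L G) :
    toTorusObservable L (plaquetteObs (d := 4) ρ 0 0 1) V =
      (ρ (V (torusEdge L ((0 : Site 4), 0)) *
        (V (torusEdge L ((Pi.single 0 1 : Site 4), 1)) *
          (V (torusEdge L ((Pi.single 1 1 : Site 4), 0)))⁻¹ *
            (V (torusEdge L ((0 : Site 4), 1)))⁻¹))).trace.re := by
  rw [toTorusObservable_plaquetteObs_apply]
  simp only [zero_add, mul_assoc]

/-- Second-letter form of the origin torus plaquette (cyclicity of the trace):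
`P₀ᵀ(V) = Re tr ρ(V t₂ · B' V)` with `B' V = (V t₃)⁻¹ (V t₄)⁻¹ V t₁`. [folklore] -/
theorem toTorusObservable_plaquetteObs_zero_second (L : ℕ) (V : GaugeConfig 4 L G) :
    toTorusObservable L (plaquetteObs (d := 4) ρ 0 0 1) V =
      (ρ (V (torusEdge L ((Pi.single 0 1 : Site 4), 1)) *
        ((V (torusEdge L ((Pi.single 1 1 : Site 4), 0)))⁻¹ *
          (V (torusEdge L ((0 : Site 4), 1)))⁻¹ *
            V (torusEdge L ((0 : Site 4), 0))))).trace.re := by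
  rw [toTorusObservable_plaquetteObs_apply]
  simp only [zero_add]
  rw [show ∀ a b c e : G, a * b * c⁻¹ * e⁻¹ = a * (b * (c⁻¹ * e⁻¹)) from fun a b c e => by group,
    trace_rho_mul_comm]
  simp only [mul_assoc]

variable [TopologicalSpace G] [IsTopologicalGroup G] [CompactSpace G] [MeasurableSpace G]
  [BorelSpace G]

/-! ### One free Haar-distributed edge -/

section FreeEdge

variable {d L : ℕ}

/-- Right-translating ONE coordinate of a torus configuration by a fixed group element preserves
the Haar product measure (compact groups are unimodular:
`haarProbability.instIsMulRightInvariant`). [folklore] -/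
theorem measurePreserving_mulCoord [NeZero L] (e₀ : Edge d L) (g : G) :
    MeasurePreserving
      (fun (V : GaugeConfig d L G) (e : Edge d L) => if e = e₀ then V e * g else V e)
      (Measure.pi fun _ : Edge d L => haarProbability G)
      (Measure.pi fun _ : Edge d L => haarProbability G) := by
  refine measurePreserving_pi (f := fun (e : Edge d L) (x : G) => if e = e₀ then x * g else x)
    (fun _ : Edge d L => haarProbability G) (fun _ : Edge d L => haarProbability G) fun e => ?_
  by_cases he : e = e₀
  · simp only [he, if_true]
    exact measurePreserving_mul_right (haarProbability G) g
  · simp only [he, if_false]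
    exact MeasurePreserving.id _

/-- **Free-edge averaging.** Under the Haar product measure, an observable `V ↦ φ (V e₀ · B V)`
with `B` independent of the edge `e₀` is uncorrelated with every observable `Y` independent of
`e₀`: `∫ φ(V e₀ · B V) Y(V) = (∫_G φ) · ∫ Y` (shear invariance, average over the shear,
Fubini, two-sided invariance of Haar measure). [folklore] -/
theorem integral_mul_eq_of_freeEdge [SecondCountableTopology G] [NeZero L] (e₀ : Edge d L)
    {φ : G → ℝ} (hφ : Continuous φ) {B : GaugeConfig d L G → G} (hBc : Continuous B)
    (hB : ∀ (V : GaugeConfig d L G) (g : G),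
      B (fun e => if e = e₀ then V e * g else V e) = B V)
    {Y : GaugeConfig d L G → ℝ} (hYc : Continuous Y)
    (hY : ∀ (V : GaugeConfig d L G) (g : G),
      Y (fun e => if e = e₀ then V e * g else V e) = Y V) :
    ∫ V, φ (V e₀ * B V) * Y V ∂(Measure.pi fun _ : Edge d L => haarProbability G) =
      (∫ h, φ h ∂(haarProbability G)) *
        ∫ V, Y V ∂(Measure.pi fun _ : Edge d L => haarProbability G) := by
  set π : Measure (GaugeConfig d L G) :=
    Measure.pi fun _ : Edge d L => haarProbability G
  obtain ⟨Cφ, hCφ⟩ := isCompact_univ.exists_bound_of_continuousOn hφ.continuousOn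
  obtain ⟨CY, hCY⟩ := isCompact_univ.exists_bound_of_continuousOn hYc.continuousOn
  have hF : Continuous fun V : GaugeConfig d L G => φ (V e₀ * B V) * Y V :=
    (hφ.comp ((continuous_apply e₀).mul hBc)).mul hYc
  -- shear invariance for every fixed `g`, then average over `g`
  have step1 : ∀ g : G,
      ∫ V, φ (V e₀ * B V) * Y V ∂π = ∫ V, φ (V e₀ * g * B V) * Y V ∂π := by
    intro g
    have hΦ := measurePreserving_mulCoord (d := d) (L := L) (G := G) e₀ g
    have key := integral_map (μ := π) hΦ.measurable.aemeasurable
      (f := fun V : GaugeConfig d L G => φ (V e₀ * B V) * Y V) hF.aestronglyMeasurable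
    rw [hΦ.map_eq] at key
    rw [key]
    refine integral_congr_ae (Eventually.of_forall fun V => ?_)
    beta_reduce
    rw [if_pos rfl, hB V g, hY V g]
  have hconst : ∫ V, φ (V e₀ * B V) * Y V ∂π =
      ∫ g, ∫ V, φ (V e₀ * g * B V) * Y V ∂π ∂(haarProbability G) := by
    have : (fun g : G => ∫ V, φ (V e₀ * g * B V) * Y V ∂π) =
        fun _ => ∫ V, φ (V e₀ * B V) * Y V ∂π := funext fun g => (step1 g).symm
    rw [this, integral_const, probReal_univ, one_smul]
  -- Fubini
  have hH : Continuous fun p : G × GaugeConfig d L G => φ (p.2 e₀ * p.1 * B p.2) * Y p.2 :=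
    (hφ.comp ((((continuous_apply e₀).comp continuous_snd).mul continuous_fst).mul
      (hBc.comp continuous_snd))).mul (hYc.comp continuous_snd)
  have hint : Integrable (fun p : G × GaugeConfig d L G => φ (p.2 e₀ * p.1 * B p.2) * Y p.2)
      ((haarProbability G).prod π) := by
    refine (integrable_const (Cφ * CY)).mono' hH.aestronglyMeasurable
      (Eventually.of_forall fun p => ?_)
    rw [Real.norm_eq_abs, abs_mul]
    exact mul_le_mul (by simpa using hCφ _ (Set.mem_univ _))
      (by simpa using hCY _ (Set.mem_univ _)) (abs_nonneg _)
      ((norm_nonneg _).trans (hCφ (p.2 e₀ * p.1 * B p.2) (Set.mem_univ _)))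
  rw [hconst, integral_integral_swap (f := fun (g : G) (V : GaugeConfig d L G) =>
    φ (V e₀ * g * B V) * Y V) hint]
  -- the inner integral is the constant `∫ φ` (left and right invariance of Haar measure)
  have hinner : ∀ V : GaugeConfig d L G,
      ∫ g, φ (V e₀ * g * B V) * Y V ∂(haarProbability G) =
        (∫ h, φ h ∂(haarProbability G)) * Y V := by
    intro V
    rw [integral_mul_const]
    congr 1
    have h1 := integral_mul_left_eq_self (μ := haarProbability G) (fun g => φ (g * B V)) (V e₀)
    have h2 := integral_mul_right_eq_self (μ := haarProbability G) φ (B V)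
    rw [h1, h2]
  simp_rw [hinner]
  exact integral_const_mul _ _

end FreeEdge

/-! ### Factorisation on the torus at `β = 0` -/

omit [IsTopologicalGroup G] [CompactSpace G] [MeasurableSpace G] [BorelSpace G] in
/-- Continuity of `h ↦ Re tr ρ(h)`. [folklore] -/
theorem continuous_traceRe (hρ : Continuous ρ) : Continuous fun h : G => (ρ h).trace.re :=
  Complex.continuous_re.comp hρ.matrix_trace

omit [CompactSpace G] [MeasurableSpace G] [BorelSpace G] in
/-- Continuity of the torus plaquette observables. [folklore] -/
theorem continuous_toTorusObservable_plaquetteObs (hρ : Continuous ρ) (L : ℕ) (y : Site 4) :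
    Continuous (toTorusObservable L (plaquetteObs (d := 4) (G := G) ρ y 0 1)) :=
  (continuous_plaquetteObs ρ hρ y 0 1).comp (continuous_pi fun _ => continuous_apply _)

/-- **`β = 0`: one free edge factorises.** If the origin torus plaquette reads
`Re tr ρ(V e₀ · B V)` with `B` independent of the edge `e₀`, and the torus plaquette at `y`
does not contain `e₀`, the two are uncorrelated under the `β = 0` Wilson (= Haar product)
measure. [folklore] -/
theorem torusPlaquette_factor_of_free [SecondCountableTopology G] (hρ : Continuous ρ)
    {L : ℕ} [NeZero L] (y : Site 4) (e₀ : Edge 4 L) {B : GaugeConfig 4 L G → G}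
    (hBc : Continuous B)
    (hB : ∀ (V : GaugeConfig 4 L G) (g : G),
      B (fun e => if e = e₀ then V e * g else V e) = B V)
    (h0 : ∀ V : GaugeConfig 4 L G,
      toTorusObservable L (plaquetteObs (d := 4) ρ 0 0 1) V = (ρ (V e₀ * B V)).trace.re)
    (hY : ∀ (V : GaugeConfig 4 L G) (g : G),
      toTorusObservable L (plaquetteObs (d := 4) ρ y 0 1)
          (fun e => if e = e₀ then V e * g else V e) =
        toTorusObservable L (plaquetteObs (d := 4) ρ y 0 1) V) :
    wilsonExpectation (L := L) ρ 0 (toTorusObservable L fun U =>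
        plaquetteObs (d := 4) ρ 0 0 1 U * plaquetteObs (d := 4) ρ y 0 1 U) =
      wilsonExpectation (L := L) ρ 0 (toTorusObservable L (plaquetteObs (d := 4) ρ 0 0 1)) *
        wilsonExpectation (L := L) ρ 0 (toTorusObservable L (plaquetteObs (d := 4) ρ y 0 1)) := by
  simp only [wilsonExpectation, S28BetaZero.wilsonMeasure_zero]
  have hprod : ∀ V : GaugeConfig 4 L G,
      toTorusObservable L
          (fun U => plaquetteObs (d := 4) ρ 0 0 1 U * plaquetteObs (d := 4) ρ y 0 1 U) V =
        (ρ (V e₀ * B V)).trace.re * toTorusObservable L (plaquetteObs (d := 4) ρ y 0 1) V :=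
    fun V => by rw [← h0]; rfl
  have key := integral_mul_eq_of_freeEdge (d := 4) (L := L) (G := G) e₀
    (continuous_traceRe ρ hρ) hBc hB (continuous_toTorusObservable_plaquetteObs ρ hρ L y) hY
  have key1 := integral_mul_eq_of_freeEdge (d := 4) (L := L) (G := G) e₀
    (continuous_traceRe ρ hρ) hBc hB (Y := fun _ => (1 : ℝ)) continuous_const (fun _ _ => rfl)
  have h1 : ∫ _V : GaugeConfig 4 L G, (1 : ℝ) ∂(Measure.pi fun _ : Edge 4 L => haarProbability G)
      = 1 := by
    rw [integral_const, probReal_univ, one_smul]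
  simp only [mul_one, h1] at key1
  beta_reduce at key key1
  simp_rw [hprod, h0]
  rw [key, key1]

/-- **Free FIRST edge.** If the torus plaquette at `y` avoids the edge `t₁ = ((0,0,0,0), 0)` of
the origin plaquette (and the period separates the origin plaquette's own third edge from
`t₁`), the two torus plaquette observables are uncorrelated at `β = 0`. [folklore] -/
theorem torusPlaquette_factor_first [SecondCountableTopology G] (hρ : Continuous ρ)
    {L : ℕ} [NeZero L] (y : Site 4)
    (ht₃ : torusEdge L ((Pi.single 1 1 : Site 4), (0 : Fin 4)) ≠ torusEdge L ((0 : Site 4), 0))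
    (hs₁ : torusEdge L (y, (0 : Fin 4)) ≠ torusEdge L ((0 : Site 4), 0))
    (hs₃ : torusEdge L (y + Pi.single 1 1, (0 : Fin 4)) ≠ torusEdge L ((0 : Site 4), 0)) :
    wilsonExpectation (L := L) ρ 0 (toTorusObservable L fun U =>
        plaquetteObs (d := 4) ρ 0 0 1 U * plaquetteObs (d := 4) ρ y 0 1 U) =
      wilsonExpectation (L := L) ρ 0 (toTorusObservable L (plaquetteObs (d := 4) ρ 0 0 1)) *
        wilsonExpectation (L := L) ρ 0 (toTorusObservable L (plaquetteObs (d := 4) ρ y 0 1)) := by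
  have hdir : ∀ a : Site 4, torusEdge L (a, (1 : Fin 4)) ≠ torusEdge L ((0 : Site 4), 0) :=
    fun a h => by simpa [torusEdge] using congrArg Prod.snd h
  refine torusPlaquette_factor_of_free ρ hρ y (torusEdge L ((0 : Site 4), 0))
    (B := fun W : GaugeConfig 4 L G => W (torusEdge L ((Pi.single 0 1 : Site 4), 1)) *
      (W (torusEdge L ((Pi.single 1 1 : Site 4), 0)))⁻¹ * (W (torusEdge L ((0 : Site 4), 1)))⁻¹)
    (by fun_prop) (fun V g => ?_) (toTorusObservable_plaquetteObs_zero_first ρ L)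
    (fun V g => ?_)
  · simp only [if_neg (hdir _), if_neg ht₃]
  · rw [toTorusObservable_plaquetteObs_apply, toTorusObservable_plaquetteObs_apply]
    simp only [if_neg (hdir _), if_neg hs₁, if_neg hs₃]

/-- **Free SECOND edge.** Same conclusion when the torus plaquette at `y` avoids the edge
`t₂ = ((1,0,0,0), 1)` of the origin plaquette, which is rewritten with `t₂` as its first
letter by cyclicity of the trace. [folklore] -/
theorem torusPlaquette_factor_second [SecondCountableTopology G] (hρ : Continuous ρ)
    {L : ℕ} [NeZero L] (y : Site 4)
    (ht₄ : torusEdge L ((0 : Site 4), (1 : Fin 4)) ≠ torusEdge L ((Pi.single 0 1 : Site 4), 1))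
    (hs₂ : torusEdge L (y + Pi.single 0 1, (1 : Fin 4)) ≠
      torusEdge L ((Pi.single 0 1 : Site 4), 1))
    (hs₄ : torusEdge L (y, (1 : Fin 4)) ≠ torusEdge L ((Pi.single 0 1 : Site 4), 1)) :
    wilsonExpectation (L := L) ρ 0 (toTorusObservable L fun U =>
        plaquetteObs (d := 4) ρ 0 0 1 U * plaquetteObs (d := 4) ρ y 0 1 U) =
      wilsonExpectation (L := L) ρ 0 (toTorusObservable L (plaquetteObs (d := 4) ρ 0 0 1)) *
        wilsonExpectation (L := L) ρ 0 (toTorusObservable L (plaquetteObs (d := 4) ρ y 0 1)) := by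
  have hdir : ∀ a : Site 4,
      torusEdge L (a, (0 : Fin 4)) ≠ torusEdge L ((Pi.single 0 1 : Site 4), 1) := fun a h => by
    simpa [torusEdge] using congrArg Prod.snd h
  refine torusPlaquette_factor_of_free ρ hρ y (torusEdge L ((Pi.single 0 1 : Site 4), 1))
    (B := fun W : GaugeConfig 4 L G => (W (torusEdge L ((Pi.single 1 1 : Site 4), 0)))⁻¹ *
      (W (torusEdge L ((0 : Site 4), 1)))⁻¹ * W (torusEdge L ((0 : Site 4), 0)))
    (by fun_prop) (fun V g => ?_) (toTorusObservable_plaquetteObs_zero_second ρ L)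
    (fun V g => ?_)
  · simp only [if_neg (hdir _), if_neg ht₄]
  · rw [toTorusObservable_plaquetteObs_apply, toTorusObservable_plaquetteObs_apply]
    simp only [if_neg (hdir _), if_neg hs₂, if_neg hs₄]

/-! ### Passage to the torus-limit states on `ℤ⁴` -/

/-- Distinct edges of `ℤ⁴` have distinct images on the torus `(ℤ/Lℤ)⁴` for all large periods
`L`. [folklore] -/
theorem eventually_torusEdge_ne {a b : Site 4 × Fin 4} (hab : a ≠ b) :
    ∀ᶠ L : ℕ in atTop, torusEdge L a ≠ torusEdge L b := by
  by_cases hdir : a.2 = b.2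
  · have hsite : a.1 ≠ b.1 := fun h => hab (Prod.ext h hdir)
    obtain ⟨l, hl⟩ : ∃ l, a.1 l ≠ b.1 l := Function.ne_iff.1 hsite
    refine eventually_atTop.2 ⟨(b.1 l - a.1 l).natAbs + 1, fun L hL h => ?_⟩
    have hco : ((a.1 l : ℤ) : ZMod L) = ((b.1 l : ℤ) : ZMod L) := by
      simpa [torusEdge] using congrArg (fun e : Edge 4 L => e.1 l) h
    rw [ZMod.intCast_eq_intCast_iff_dvd_sub] at hco
    have hlt : |b.1 l - a.1 l| < (L : ℤ) := by
      rw [Int.abs_eq_natAbs]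
      exact_mod_cast hL
    exact hl (eq_of_sub_eq_zero (Int.eq_zero_of_abs_lt_dvd hco hlt)).symm
  · exact Eventually.of_forall fun L h => hdir (by simpa [torusEdge] using congrArg Prod.snd h)

/-- **ULTRA-LOCALITY AT `β = 0`.** For every compact metrisable gauge group `G`, every
continuous matrix representation `ρ` and every torus-limit state `μ` of the `d = 4` Wilson
theory at `β = 0`, the connected plaquette two-point function vanishes at EVERY non-zero
separation `x` — including the separations at which the two plaquettes share an edge (one free
Haar-distributed edge of the origin plaquette already decorrelates them). [folklore] -/
theorem plaquetteCorrFn_eq_zero_of_ne_zero [SecondCountableTopology G] (hρ : Continuous ρ)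
    {μ : Measure (LGConfig 4 G)} (hμ : μ ∈ infiniteVolumeLimitPoints (d := 4) ρ 0)
    {x : Site 4} (hx : x ≠ 0) : plaquetteCorrFn ρ μ x = 0 := by
  obtain ⟨Ls, hLs, hlim⟩ := hμ
  have hT : Tendsto (fun k : ℕ => Ls k + 1) atTop atTop :=
    tendsto_atTop_mono (fun k => (hLs.id_le k).trans (Nat.le_succ _)) tendsto_id
  have E : ∀ {a b : Site 4 × Fin 4}, a ≠ b →
      ∀ᶠ k : ℕ in atTop, torusEdge (Ls k + 1) a ≠ torusEdge (Ls k + 1) b :=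
    fun hab => hT.eventually (eventually_torusEdge_ne hab)
  -- the shifted plaquette is the plaquette at `x`
  have hshift : ∀ U : LGConfig 4 G, plaquetteObs (d := 4) ρ 0 0 1 (configShift (-x) U) =
      plaquetteObs (d := 4) ρ x 0 1 U := fun U => by rw [plaquetteObs_configShift]; simp
  have hfun1 : (fun U : LGConfig 4 G => plaquetteObs (d := 4) ρ 0 0 1 U *
      plaquetteObs (d := 4) ρ 0 0 1 (configShift (-x) U)) =
      fun U => plaquetteObs (d := 4) ρ 0 0 1 U * plaquetteObs (d := 4) ρ x 0 1 U :=
    funext fun U => by rw [hshift]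
  have hfun2 : (plaquetteObs (d := 4) ρ 0 0 1 ∘ configShift (-x) : LGConfig 4 G → ℝ) =
      plaquetteObs (d := 4) ρ x 0 1 := funext fun U => hshift U
  -- eventual exact factorisation on the tori
  have hev : ∀ᶠ k : ℕ in atTop,
      wilsonExpectation (L := Ls k + 1) ρ 0 (toTorusObservable (Ls k + 1) fun U =>
          plaquetteObs (d := 4) ρ 0 0 1 U * plaquetteObs (d := 4) ρ x 0 1 U) =
        wilsonExpectation (L := Ls k + 1) ρ 0
            (toTorusObservable (Ls k + 1) (plaquetteObs (d := 4) ρ 0 0 1)) *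
          wilsonExpectation (L := Ls k + 1) ρ 0
            (toTorusObservable (Ls k + 1) (plaquetteObs (d := 4) ρ x 0 1)) := by
    by_cases hcase : x + Pi.single 1 1 = 0
    · -- `x = -e₁`: the plaquette at `x` contains `t₁`; free the second edge `t₂` instead
      have hx' : x = -Pi.single 1 1 := eq_neg_of_add_eq_zero_left hcase
      have n1 : (((0 : Site 4), (1 : Fin 4)) : Site 4 × Fin 4) ≠
          ((Pi.single 0 1 : Site 4), (1 : Fin 4)) := fun h => by
        simpa using congrArg (fun e : Site 4 × Fin 4 => e.1 0) h
      have n2 : ((x + Pi.single 0 1, (1 : Fin 4)) : Site 4 × Fin 4) ≠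
          ((Pi.single 0 1 : Site 4), (1 : Fin 4)) := fun h =>
        hx (by simpa using congrArg Prod.fst h)
      have n3 : ((x, (1 : Fin 4)) : Site 4 × Fin 4) ≠ ((Pi.single 0 1 : Site 4), (1 : Fin 4)) :=
        fun h => by simpa [hx'] using congrArg (fun e : Site 4 × Fin 4 => e.1 0) h
      filter_upwards [E n1, E n2, E n3] with k h1 h2 h3
      exact torusPlaquette_factor_second ρ hρ x h1 h2 h3
    · -- generic case: free the first edge `t₁`
      have n1 : (((Pi.single 1 1 : Site 4), (0 : Fin 4)) : Site 4 × Fin 4) ≠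
          ((0 : Site 4), (0 : Fin 4)) := fun h => by
        simpa using congrArg (fun e : Site 4 × Fin 4 => e.1 1) h
      have n2 : ((x, (0 : Fin 4)) : Site 4 × Fin 4) ≠ ((0 : Site 4), (0 : Fin 4)) := fun h =>
        hx (congrArg Prod.fst h)
      have n3 : ((x + Pi.single 1 1, (0 : Fin 4)) : Site 4 × Fin 4) ≠ ((0 : Site 4), (0 : Fin 4)) :=
        fun h => hcase (congrArg Prod.fst h)
      filter_upwards [E n1, E n2, E n3] with k h1 h2 h3
      exact torusPlaquette_factor_first ρ hρ x h1 h2 h3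
  have key := S28TorusAxialStrong.abs_plaquetteCorrFn_le_of_eventually ρ hρ hlim (-x) (b := 0)
    (hev.mono fun k hk => by rw [hfun1, hfun2, hk, sub_self, abs_zero])
  rw [neg_neg] at key
  exact abs_nonpos_iff.1 key

/-- **Every exponential decay rate at `β = 0`.** The two-point function of every torus-limit
state at `β = 0` satisfies `|f(x)| ≤ |f(0)| e^{-m‖x‖}` for EVERY `m > 0`: in the `ℓ^∞` sense
its correlation length is `0`.  The endpoint `β = 0` of the `S28ᵀ` β-axis is thus DEGENERATE
(ultra-local), not massless; the gap clause fails there only because `HasInvCorrLength` reads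
the identically vanishing axial values through `Real.log 0 = 0`
(`S28BetaZero.hasInvCorrLength_zero_of_beta_zero`). [folklore] -/
theorem hasExponentialDecayRate_of_beta_zero [SecondCountableTopology G] (hρ : Continuous ρ)
    {μ : Measure (LGConfig 4 G)} (hμ : μ ∈ infiniteVolumeLimitPoints (d := 4) ρ 0)
    {m : ℝ} (hm : 0 < m) : HasExponentialDecayRate (plaquetteCorrFn ρ μ) m := by
  refine ⟨hm, |plaquetteCorrFn ρ μ 0|, fun x => ?_⟩
  by_cases hx : x = 0
  · subst hx
    simp
  · rw [plaquetteCorrFn_eq_zero_of_ne_zero ρ hρ hμ hx, abs_zero]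
    positivity

/-- **The degenerate endpoint, summarised.** Every torus-limit state at `β = 0` is ultra-local
and has every exponential decay rate, while its axial inverse correlation length in the sense
of `HasInvCorrLength` is `0` (junk value `log 0 = 0`), so it carries NO positive
`HasInvCorrLength` rate. [folklore] -/
theorem betaZero_degenerate [SecondCountableTopology G] (hρ : Continuous ρ)
    {μ : Measure (LGConfig 4 G)} (hμ : μ ∈ infiniteVolumeLimitPoints (d := 4) ρ 0) :
    (∀ x : Site 4, x ≠ 0 → plaquetteCorrFn ρ μ x = 0) ∧
      (∀ m : ℝ, 0 < m → HasExponentialDecayRate (plaquetteCorrFn ρ μ) m) ∧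
      HasInvCorrLength (plaquetteCorrFn ρ μ) 0 ∧
      ¬ ∃ m : ℝ, 0 < m ∧ HasInvCorrLength (plaquetteCorrFn ρ μ) m :=
  ⟨fun _ hx => plaquetteCorrFn_eq_zero_of_ne_zero ρ hρ hμ hx,
    fun _ hm => hasExponentialDecayRate_of_beta_zero ρ hρ hμ hm,
    S28BetaZero.hasInvCorrLength_zero_of_beta_zero ρ hρ hμ,
    S28BetaZero.not_posRate_of_beta_zero ρ hρ hμ⟩

/-- **Non-vacuous form**: a torus-limit state at `β = 0` exists (Prokhorov) and is
ultra-local with every exponential decay rate. [folklore] -/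
theorem exists_limitState_beta_zero_ultraLocal [T2Space G] [SecondCountableTopology G]
    (hρ : Continuous ρ) :
    ∃ μ ∈ infiniteVolumeLimitPoints (d := 4) ρ 0,
      (∀ x : Site 4, x ≠ 0 → plaquetteCorrFn ρ μ x = 0) ∧
        ∀ m : ℝ, 0 < m → HasExponentialDecayRate (plaquetteCorrFn ρ μ) m := by
  obtain ⟨μ, hμ⟩ := infiniteVolumeLimitPoints_nonempty_holds (d := 4) ρ hρ 0
  exact ⟨μ, hμ, (betaZero_degenerate ρ hρ hμ).1, (betaZero_degenerate ρ hρ hμ).2.1⟩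

end Summit.QuantumFields.YangMills.Theorems.S28BetaZeroUltraLocal

end
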